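import Literature.Geometry.DiscreteGeometry.KissingCertComp
import Literature.Geometry.DiscreteGeometry.KissingCertDataA
import Literature.Geometry.DiscreteGeometry.KissingCertDataB
import Literature.Geometry.DiscreteGeometry.KissingCertDataC

/-!
# Certificate for `k(4) < 25`: validation of the expansion of `F`

Block-chunked kernel validation (`FchunkOK`, `decide`) that the claimed expansion of the three-point
polynomial `F_int` (flat data `certFPf*`) agrees with the reflectively computed `FPoly` of the `F`
blocks (weights `certFws*`): the blocks `< n1` sum to `certFD1f*`, the blocks `< n1 + n2` to
`certFD2f*`, and all blocks to `certFPf*` (combined by `fexpValid_of_chunks`).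

The statements are written directly in terms of the raw data of `KissingCertData{A,B,C}`
(decoded by `ofFlat`) and the checker of `KissingCertComp`; they are combined in
`KissingNumberFourProofs`.
-/

namespace Literature.Geometry.DiscreteGeometry

open PolyCert PolyCert.SPoly KissingFourCert

set_option maxHeartbeats 0 in
/-- `F` blocks `0 … n1-1`. [folklore] -/
theorem certP_F1 :
    FchunkOK ([FBlk.mk 0 certFws0, FBlk.mk 1 certFws1, FBlk.mk 2 certFws2, FBlk.mk 3 certFws3, FBlk.mk 4 certFws4, FBlk.mk 5 certFws5, FBlk.mk 6 certFws6, FBlk.mk 7 certFws7].take certFn1) []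
      (ofFlat certFD1f0 ++ ofFlat certFD1f1 ++ ofFlat certFD1f2) = true := by
  decide +kernel

set_option maxHeartbeats 0 in
/-- `F` blocks `n1 … n1+n2-1`. [folklore] -/
theorem certP_F2 :
    FchunkOK (([FBlk.mk 0 certFws0, FBlk.mk 1 certFws1, FBlk.mk 2 certFws2, FBlk.mk 3 certFws3, FBlk.mk 4 certFws4, FBlk.mk 5 certFws5, FBlk.mk 6 certFws6, FBlk.mk 7 certFws7].drop certFn1).take certFn2)
      (ofFlat certFD1f0 ++ ofFlat certFD1f1 ++ ofFlat certFD1f2)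
      (ofFlat certFD2f0 ++ ofFlat certFD2f1 ++ ofFlat certFD2f2) = true := by
  decide +kernel

set_option maxHeartbeats 0 in
/-- `F` blocks `n1+n2 …`. [folklore] -/
theorem certP_F3 :
    FchunkOK (([FBlk.mk 0 certFws0, FBlk.mk 1 certFws1, FBlk.mk 2 certFws2, FBlk.mk 3 certFws3, FBlk.mk 4 certFws4, FBlk.mk 5 certFws5, FBlk.mk 6 certFws6, FBlk.mk 7 certFws7].drop certFn1).drop certFn2)
      (ofFlat certFD2f0 ++ ofFlat certFD2f1 ++ ofFlat certFD2f2)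
      (ofFlat certFPf0 ++ ofFlat certFPf1 ++ ofFlat certFPf2) = true := by
  decide +kernel

end Literature.Geometry.DiscreteGeometry
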